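import Literature.MathematicalPhysics.QuantumFieldTheory.ONArchipelagoSystem
import Literature.MathematicalPhysics.QuantumFieldTheory.ConformalBootstrap3D.DualFunctional
import HarnessLib

/-!
# The seven-component dual functional of the `O(N)` archipelago system

Companion to `ONArchipelagoSystem.lean` (the typed `O(N)` archipelago axioms A1–A5 for the vector
`φ_i` and the singlet `s`, Kos–Poland–Simmons-Duffin–Vichi 2015, §2.1–2.2) in the role that
`ConformalBootstrap3D/DualFunctional.lean` plays for the `σ–ε` system: it states WHAT A CERTIFICATE IS
and proves WHAT IT PROVES.

* `ArchipelagoFunctional` — a 7-vector `α⃗ = (α₁, …, α₇)` of real-linear functionals on functions of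
  `(z, z̄)`, `αᵢ` acting on the `i`-th sum rule of `ArchipelagoData.SatisfiesCrossing` (source §2.2:
  "we must find a vector of linear functionals `α⃗ = (α₁, α₂, ..., α₇)` such that …").
* The scalar / quadratic forms `α⃗·V⃗` of the five kinds of contributions, READ OFF the seven typed
  sum rules (so that the signs are those of the tree, including the 2014 `A`-row convention and the
  ERRATUM placement of the spin-parity sign on the `V` rows): `identityTerm`, `singletForm` (the `2×2`
  form of an even-spin singlet in `(λ_{φφ𝒪}, λ_{ss𝒪})`), `tensorForm`, `antiForm`, `vectorForm`, and
  the external form `extForm = singletForm[g_s] + a²·vectorForm[ℓ = 0, g_φ]` — the source's combined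
  constraint `α⃗·(V⃗_{S,Δ_s,0} + V⃗_{V,Δ_φ,0} ⊗ (1 0; 0 0)) ⪰ 0`, which "imposes the appearance of
  `φ_i, s` in the OPEs and incorporates the equality `λ_{φφs} = λ_{φsφ}`" (§2.2, eq. (example)).
* `IsPositiveAt α N A Δ_φ Δ_s` — the positivity conditions of §2.2 against the parametrised gaps
  `A : ArchipelagoGaps`, with the identity condition strict (`> 0`, as in Kos–Poland–Simmons-Duffin
  2014, eq. (3.16); the source's `≥ 0` is the SDP normalisation of the same search).
* `AppliesTermwise` (T4) and the exclusion theorem `not_isPositiveAt_of_appliesTermwise`, PROVED: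
  a datum satisfying A1, A2, A4, A5 on which `α⃗` acts termwise cannot have `α⃗` positive at its own
  `(Δ_φ, Δ_s)` ("If such a functional exists for a hypothetical CFT spectrum, then that spectrum is
  inconsistent with crossing symmetry", §2.2).  The proof adds the seven dualised rows: the singlet,
  tensor, antisymmetric and vector series have non-negative terms, the external operators contribute
  `extForm` at `(λ_{φφs}, λ_{sss})` (this is where A5 enters), and everything adds up to minus the
  identity term.
* Termwise action is a THEOREM for evaluation-continuous functionals
  (`appliesTermwise_of_isEvaluationContinuous`, using `EvaluationContinuous` of the `σ–ε` file), hence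
  for point-evaluation 7-vectors `ofPoints`; the end products are `boxExcluded_of_functional` and
  `boxExcluded_of_pointFunctional : … → BoxExcluded N A Q`, the hypothesis of
  `archipelagoEnclosure_of_cover`.
* Entrywise `2×2` criteria a rational certificate checks: `singletForm_nonneg_of_det`,
  `extForm_nonneg_of_det` (via `quadForm_nonneg_of_det`), and `extForm_nonneg_of_separate` (the
  source's remark that without gaps at `s`, `φ` the combined constraint is implied by the separate ones).
* `archipelagoEnclosure_of_grid` — assembly of one certificate per grid cell of a window
  `[x₀, x_K] × [y₀, y_M]` into `ArchipelagoEnclosure N A W R`.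

What this file does NOT contain: any concrete functional or certificate, any island; termwise action
for derivative functionals; anything about `N`-dependence beyond the literal factors `1 ∓ 2/N` of the
sum rules (`N = 0` is not excluded by the types; the factors are then the junk value `1`).

Sources: F. Kos, D. Poland, D. Simmons-Duffin, A. Vichi, *Bootstrapping the O(N) archipelago*, JHEP 11
(2015) 106, arXiv:1504.07997, §2.2 (bib key `KosPolandSimmonsDuffinVichi2015`); F. Kos, D. Poland,
D. Simmons-Duffin, JHEP 11 (2014) 109, §3.2–3.3 eqs. (3.13)–(3.16) (the dual argument, bib key
`KosPolandSimmonsduffin2014`); M. Hogervorst, S. Rychkov, Nucl. Phys. B 865 (2013), §4.3 (point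
functionals); R. Rattazzi, V. S. Rychkov, E. Tonni, A. Vichi, JHEP 12 (2008) 031, §5.  Mathlib:
`LinearMap`, `HasSum.add/sub/mul_left/nonneg`, `hasSum_sum`.
-/

namespace Literature.MathematicalPhysics.QuantumFieldTheory.ONArchipelagoSystem

open Set
open ConformalBootstrap3D (IsConformalBlock3D unitarityBound3D crossF EvaluationContinuous
  pointFunctional pointFunctional_apply evaluationContinuous_pointFunctional quadForm_nonneg_of_det)

/-! ### §1 The functional and the forms `α⃗·V⃗` -/

/-- A 7-vector `α⃗ = (α₁, …, α₇)` of real-linear functionals on functions of `(z, z̄)`, `αᵢ` acting on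
row `i` of `ArchipelagoData.SatisfiesCrossing` (source §2.2: "a vector of linear functionals
`α⃗ = (α₁,α₂,...,α₇)`"). [cite: KosPolandSimmonsDuffinVichi2015, §2.2 (functional conditions)] -/
structure ArchipelagoFunctional where
  /-- `α₁`, applied to row 1 (`⟨φφφφ⟩`, `T − A`). -/
  α₁ : (ℝ → ℝ → ℝ) →ₗ[ℝ] ℝ
  /-- `α₂`, applied to row 2 (`⟨φφφφ⟩`, `F₋`). -/
  α₂ : (ℝ → ℝ → ℝ) →ₗ[ℝ] ℝ
  /-- `α₃`, applied to row 3 (`⟨φφφφ⟩`, `F₊`). -/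
  α₃ : (ℝ → ℝ → ℝ) →ₗ[ℝ] ℝ
  /-- `α₄`, applied to row 4 (`⟨ssss⟩`). -/
  α₄ : (ℝ → ℝ → ℝ) →ₗ[ℝ] ℝ
  /-- `α₅`, applied to row 5 (`⟨φsφs⟩`, vectors only). -/
  α₅ : (ℝ → ℝ → ℝ) →ₗ[ℝ] ℝ
  /-- `α₆`, applied to row 6 (`F₋` part of `⟨φφss⟩`). -/
  α₆ : (ℝ → ℝ → ℝ) →ₗ[ℝ] ℝ
  /-- `α₇`, applied to row 7 (`F₊` part of `⟨φφss⟩`). -/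
  α₇ : (ℝ → ℝ → ℝ) →ₗ[ℝ] ℝ

namespace ArchipelagoFunctional

/-- The identity contribution `(1 1) α⃗·V⃗_{S,0,0} (1 1)ᵀ`: block `1`, unit couplings, in rows 2, 3
(prefactor exponent `Δ_φ`), 4 (`Δ_s`), 6, 7 (`h = (Δ_φ+Δ_s)/2`) — read off `SatisfiesCrossing`.
[cite: KosPolandSimmonsDuffinVichi2015, §2.2 (functional conditions)] -/
noncomputable def identityTerm (α : ArchipelagoFunctional) (Δφ Δs : ℝ) : ℝ :=
  α.α₂ (crossF Δφ (-1) (fun _ _ => (1 : ℝ))) + α.α₃ (crossF Δφ 1 (fun _ _ => (1 : ℝ)))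
    + α.α₄ (crossF Δs (-1) (fun _ _ => (1 : ℝ)))
    + α.α₆ (crossF ((Δφ + Δs) / 2) (-1) (fun _ _ => (1 : ℝ)))
    + α.α₇ (crossF ((Δφ + Δs) / 2) 1 (fun _ _ => (1 : ℝ)))

/-- The `2×2` quadratic form `(a b) α⃗·V⃗_{S,Δ,ℓ} (a b)ᵀ` of an even-spin singlet with block
`g = g^{0,0}_{Δ,ℓ}` and couplings `(a, b) = (λ_{φφ𝒪}, λ_{ss𝒪})`: `a²(α₂[F⁻_{Δφ} g] + α₃[F⁺_{Δφ} g])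
+ b² α₄[F⁻_{Δs} g] + ab(α₆[F⁻_h g] + α₇[F⁺_h g])` — rows 2, 3, 4, 6, 7 of `SatisfiesCrossing`.
[cite: KosPolandSimmonsDuffinVichi2015, §2.2 (functional conditions)] -/
noncomputable def singletForm (α : ArchipelagoFunctional) (Δφ Δs : ℝ) (g : ℝ → ℝ → ℝ) (a b : ℝ) : ℝ :=
  a ^ 2 * (α.α₂ (crossF Δφ (-1) g) + α.α₃ (crossF Δφ 1 g)) + b ^ 2 * α.α₄ (crossF Δs (-1) g)
    + a * b * (α.α₆ (crossF ((Δφ + Δs) / 2) (-1) g) + α.α₇ (crossF ((Δφ + Δs) / 2) 1 g))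

/-- `α⃗·V⃗_{T,Δ,ℓ}` for a traceless symmetric tensor with block `g`: `α₁[F⁻ g] + (1 − 2/N) α₂[F⁻ g]
− (1 + 2/N) α₃[F⁺ g]` (prefactor exponent `Δ_φ`; rows 1–3).
[cite: KosPolandSimmonsDuffinVichi2015, §2.1 (seven equations; `V⃗_T, V⃗_A, V⃗_V, V⃗_S`)] -/
noncomputable def tensorForm (α : ArchipelagoFunctional) (N : ℕ) (Δφ : ℝ) (g : ℝ → ℝ → ℝ) : ℝ :=
  α.α₁ (crossF Δφ (-1) g) + (1 - 2 / (N : ℝ)) * α.α₂ (crossF Δφ (-1) g)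
    - (1 + 2 / (N : ℝ)) * α.α₃ (crossF Δφ 1 g)

/-- `α⃗·V⃗_{A,Δ,ℓ}` for an antisymmetric tensor with block `g`, in the 2014 convention of the tree
(`V⃗_A = (−F⁻, F⁻, −F⁺)`): `−α₁[F⁻ g] + α₂[F⁻ g] − α₃[F⁺ g]`.
[cite: KosPolandSimmonsDuffinVichi2015, §2.1 (seven equations; `V⃗_T, V⃗_A, V⃗_V, V⃗_S`)] -/
noncomputable def antiForm (α : ArchipelagoFunctional) (Δφ : ℝ) (g : ℝ → ℝ → ℝ) : ℝ :=
  -α.α₁ (crossF Δφ (-1) g) + α.α₂ (crossF Δφ (-1) g) - α.α₃ (crossF Δφ 1 g)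

/-- `α⃗·V⃗_{V,Δ,ℓ}` for an `O(N)` vector of `φ×s` of spin `ℓ` with blocks `g₁ = g^{Δ_φs,Δ_φs}_{Δ,ℓ}`
(row 5) and `g₂ = g^{-Δ_φs,Δ_φs}_{Δ,ℓ}` (rows 6, 7): `(−1)^ℓ α₅[F⁻_h g₁] + α₆[F⁻_{Δφ} g₂] − α₇[F⁺_{Δφ} g₂]`
— literally `CrossingFunctional.oddForm` of the `σ–ε` file with `(α³, α⁴, α⁵) ↦ (α₅, α₆, α₇)`
(ERRATUM sign placement). [cite: KosPolandSimmonsDuffinVichi2015, §2.1 (seven equations; `V⃗_T, V⃗_A, V⃗_V, V⃗_S`)] -/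
noncomputable def vectorForm (α : ArchipelagoFunctional) (Δφ Δs : ℝ) (ℓ : ℕ) (g₁ g₂ : ℝ → ℝ → ℝ) : ℝ :=
  (-1 : ℝ) ^ ℓ * α.α₅ (crossF ((Δφ + Δs) / 2) (-1) g₁) + α.α₆ (crossF Δφ (-1) g₂)
    - α.α₇ (crossF Δφ 1 g₂)

/-- The external form `(a b) α⃗·(V⃗_{S,Δ_s,0} + V⃗_{V,Δ_φ,0} ⊗ (1 0; 0 0)) (a b)ᵀ` with `(a, b) =
(λ_{φφs}, λ_{sss})`: the joint contribution of `s` (block `g_s`, rows 2, 3, 4, 6, 7) and of `φ` (blocks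
`g_φ^∓`, rows 5, 6, 7, coupling `λ_{φsφ} = λ_{φφs} = a` by A5) — "The final constraint … imposes the
appearance of `φ_i, s` in the OPEs and incorporates the equality `λ_{φφs} = λ_{φsφ}`. It replaces two
otherwise independent constraints on `V_S` and `V_V`" (source §2.2).
[cite: KosPolandSimmonsDuffinVichi2015, §2.2 (OPE-coefficient symmetry)] -/
noncomputable def extForm (α : ArchipelagoFunctional) (Δφ Δs : ℝ) (gs gφm gφp : ℝ → ℝ → ℝ) (a b : ℝ) :
    ℝ :=
  α.singletForm Δφ Δs gs a b + a ^ 2 * α.vectorForm Δφ Δs 0 gφm gφp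

/-- **The positivity conditions of `α⃗` at the external point `(Δ_φ, Δ_s)` against the gaps `A`**
(source §2.2, the five displayed conditions and eq. (example)): (i) identity term `> 0`; (ii) `α⃗·V⃗_T ≥ 0`
for every even-spin traceless symmetric tensor above the unitarity bound, scalars above `Δ_T^*`;
(iii) `α⃗·V⃗_A ≥ 0` for every odd-spin antisymmetric tensor above the bound; (iv) `α⃗·V⃗_V ≥ 0` for every
vector above the bound, scalars above `Δ_V^*`, and every pair of genuine blocks `g^{±Δ_φs,Δ_φs}_{Δ,ℓ}`;
(v) `α⃗·V⃗_S ⪰ 0` for every even-spin singlet above the bound, scalars above `Δ_S^*`; (vi) the external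
form `⪰ 0` for every triple of genuine blocks of `s` and `φ`.  Every clause quantifies over ALL functions
that are the genuine block (`IsConformalBlock3D`), and the spectral side conditions are copied from
`SatisfiesUnitarity` / `SatisfiesGaps`, so the hypothesis is exactly as strong as the assumptions of the
numerics. [cite: KosPolandSimmonsDuffinVichi2015, §2.2 (functional conditions)] -/
def IsPositiveAt (α : ArchipelagoFunctional) (N : ℕ) (A : ArchipelagoGaps) (Δφ Δs : ℝ) : Prop :=
  0 < α.identityTerm Δφ Δs ∧
    (∀ (Δ : ℝ) (ℓ : ℕ) (g : ℝ → ℝ → ℝ), Even ℓ → unitarityBound3D ℓ ≤ Δ → (ℓ = 0 → A.ΔTstar ≤ Δ) →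
        IsConformalBlock3D 0 0 Δ ℓ g → 0 ≤ α.tensorForm N Δφ g) ∧
    (∀ (Δ : ℝ) (ℓ : ℕ) (g : ℝ → ℝ → ℝ), Odd ℓ → unitarityBound3D ℓ ≤ Δ →
        IsConformalBlock3D 0 0 Δ ℓ g → 0 ≤ α.antiForm Δφ g) ∧
    (∀ (Δ : ℝ) (ℓ : ℕ) (g₁ g₂ : ℝ → ℝ → ℝ), unitarityBound3D ℓ ≤ Δ → (ℓ = 0 → A.ΔVstar ≤ Δ) →
        IsConformalBlock3D (Δφ - Δs) (Δφ - Δs) Δ ℓ g₁ → IsConformalBlock3D (-(Δφ - Δs)) (Δφ - Δs) Δ ℓ g₂ →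
          0 ≤ α.vectorForm Δφ Δs ℓ g₁ g₂) ∧
    (∀ (Δ : ℝ) (ℓ : ℕ) (g : ℝ → ℝ → ℝ), Even ℓ → unitarityBound3D ℓ ≤ Δ → (ℓ = 0 → A.ΔSstar ≤ Δ) →
        IsConformalBlock3D 0 0 Δ ℓ g → ∀ a b : ℝ, 0 ≤ α.singletForm Δφ Δs g a b) ∧
    ∀ (gs gφm gφp : ℝ → ℝ → ℝ), IsConformalBlock3D 0 0 Δs 0 gs →
        IsConformalBlock3D (Δφ - Δs) (Δφ - Δs) Δφ 0 gφm → IsConformalBlock3D (-(Δφ - Δs)) (Δφ - Δs) Δφ 0 gφp →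
          ∀ a b : ℝ, 0 ≤ α.extForm Δφ Δs gs gφm gφp a b

/-- Larger gaps weaken the positivity conditions: positivity against `A` implies positivity against any
`A'` with componentwise larger thresholds ("Additional information about the spectrum can weaken the
above constraints", source §2.2). [cite: KosPolandSimmonsDuffinVichi2015, §2.2 (assumptions; eq. example)] -/
theorem IsPositiveAt.of_le {α : ArchipelagoFunctional} {N : ℕ} {A A' : ArchipelagoGaps} {Δφ Δs : ℝ}
    (h : α.IsPositiveAt N A Δφ Δs) (hS : A.ΔSstar ≤ A'.ΔSstar) (hV : A.ΔVstar ≤ A'.ΔVstar)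
    (hT : A.ΔTstar ≤ A'.ΔTstar) : α.IsPositiveAt N A' Δφ Δs := by
  obtain ⟨hI, hTp, hAp, hVp, hSp, hE⟩ := h
  refine ⟨hI, fun Δ ℓ g hev hb hgap hg => hTp Δ ℓ g hev hb (fun h0 => hT.trans (hgap h0)) hg, hAp,
    fun Δ ℓ g₁ g₂ hb hgap hg₁ hg₂ => hVp Δ ℓ g₁ g₂ hb (fun h0 => hV.trans (hgap h0)) hg₁ hg₂,
    fun Δ ℓ g hev hb hgap hg => hSp Δ ℓ g hev hb (fun h0 => hS.trans (hgap h0)) hg, hE⟩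

/-! ### §2 Termwise action and the exclusion theorem -/

/-- **Termwise action (T4) of `α⃗` on the datum `D`**: applying `αᵢ` term by term to row `i` of
`D.SatisfiesCrossing` gives convergent real series whose sums satisfy the dualised row — rows 4, 5
literally, rows 1, 2, 3, 6, 7 with the sector sums named as in `SatisfiesCrossing`.  The sole analytic
input of the dual argument; a theorem for evaluation-continuous `α⃗`
(`appliesTermwise_of_isEvaluationContinuous`). (Kos–Poland–Simmons-Duffin 2014, §3.2: "Acting on (3.11)
with this functional gives the dual form of crossing equation".)
[cite: KosPolandSimmonsduffin2014, §3.2 eq. (3.13)–(3.15)] -/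
def AppliesTermwise {N : ℕ} (α : ArchipelagoFunctional) (D : ArchipelagoData N) : Prop :=
  (∃ ST SA : ℝ,
    HasSum (fun i => D.lamT i ^ 2 * α.α₁ (crossF D.Δφ (-1) (D.gT i))) ST ∧
      HasSum (fun i => D.lamA i ^ 2 * α.α₁ (crossF D.Δφ (-1) (D.gA i))) SA ∧ ST - SA = 0) ∧
  (∃ SS ST SA : ℝ,
    HasSum (fun i => D.lamφφS i ^ 2 * α.α₂ (crossF D.Δφ (-1) (D.gS i))) SS ∧
      HasSum (fun i => D.lamT i ^ 2 * α.α₂ (crossF D.Δφ (-1) (D.gT i))) ST ∧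
      HasSum (fun i => D.lamA i ^ 2 * α.α₂ (crossF D.Δφ (-1) (D.gA i))) SA ∧
        α.α₂ (crossF D.Δφ (-1) (fun _ _ => 1)) + D.lamφφs ^ 2 * α.α₂ (crossF D.Δφ (-1) D.gs) + SS +
          (1 - 2 / (N : ℝ)) * ST + SA = 0) ∧
  (∃ SS ST SA : ℝ,
    HasSum (fun i => D.lamφφS i ^ 2 * α.α₃ (crossF D.Δφ 1 (D.gS i))) SS ∧
      HasSum (fun i => D.lamT i ^ 2 * α.α₃ (crossF D.Δφ 1 (D.gT i))) ST ∧
      HasSum (fun i => D.lamA i ^ 2 * α.α₃ (crossF D.Δφ 1 (D.gA i))) SA ∧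
        α.α₃ (crossF D.Δφ 1 (fun _ _ => 1)) + D.lamφφs ^ 2 * α.α₃ (crossF D.Δφ 1 D.gs) + SS -
          (1 + 2 / (N : ℝ)) * ST - SA = 0) ∧
  HasSum (fun i => D.lamssS i ^ 2 * α.α₄ (crossF D.Δs (-1) (D.gS i)))
    (-(α.α₄ (crossF D.Δs (-1) (fun _ _ => 1)) + D.lamsss ^ 2 * α.α₄ (crossF D.Δs (-1) D.gs))) ∧
  HasSum (fun j => (-1 : ℝ) ^ D.ℓV j * D.lamV j ^ 2 * α.α₅ (crossF D.Δh (-1) (D.gVm j)))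
    (-(D.lamφsφ ^ 2 * α.α₅ (crossF D.Δh (-1) D.gφm))) ∧
  (∃ SS SV : ℝ,
    HasSum (fun i => D.lamφφS i * D.lamssS i * α.α₆ (crossF D.Δh (-1) (D.gS i))) SS ∧
      HasSum (fun j => D.lamV j ^ 2 * α.α₆ (crossF D.Δφ (-1) (D.gVp j))) SV ∧
        α.α₆ (crossF D.Δh (-1) (fun _ _ => 1)) + D.lamφφs * D.lamsss * α.α₆ (crossF D.Δh (-1) D.gs) + SS +
          D.lamφsφ ^ 2 * α.α₆ (crossF D.Δφ (-1) D.gφp) + SV = 0) ∧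
  ∃ SS SV : ℝ,
    HasSum (fun i => D.lamφφS i * D.lamssS i * α.α₇ (crossF D.Δh 1 (D.gS i))) SS ∧
      HasSum (fun j => D.lamV j ^ 2 * α.α₇ (crossF D.Δφ 1 (D.gVp j))) SV ∧
        α.α₇ (crossF D.Δh 1 (fun _ _ => 1)) + D.lamφφs * D.lamsss * α.α₇ (crossF D.Δh 1 D.gs) + SS -
          D.lamφsφ ^ 2 * α.α₇ (crossF D.Δφ 1 D.gφp) - SV = 0

/-- **The dual-functional argument, PROVED — core form with the external clause AT THE COUPLINGS.**
As `not_isPositiveAt_of_appliesTermwise` below, but the six positivity clauses are separate hypotheses and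
clause (vi) (the external form) is required only at the datum's own couplings `(λ_{φφs}, λ_{sss})` — the
form an OPE-angle scan uses (positivity of the external form on a cone of directions containing the
datum's).  Original docstring: ("If such a functional exists for a hypothetical CFT
spectrum, then that spectrum is inconsistent with crossing symmetry", source §2.2): a datum satisfying A1
(bounds, parities), A2 (genuine blocks), A4 (gaps against `A`) and A5 (`λ_{φsφ} = λ_{φφs}`), on which `α⃗`
acts termwise, cannot have `α⃗` positive at its own `(Δ_φ, Δ_s)` against `A`.  Proof: dualise the seven
rows and add; the singlet series `Σ_S (λ_{φφ𝒪} λ_{ss𝒪}) α⃗·V⃗_S (…)ᵀ`, the tensor, antisymmetric and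
vector series `Σ λ² α⃗·V⃗` have non-negative terms, the external operators contribute
`extForm (λ_{φφs}, λ_{sss}) ≥ 0`, and the total is minus the identity term `< 0`.
[cite: KosPolandSimmonsduffin2014, §3.3 eq. (3.16)] -/
theorem not_positiveAtCouplings_of_appliesTermwise {N : ℕ} (α : ArchipelagoFunctional)
    (D : ArchipelagoData N) (A : ArchipelagoGaps) (hU : D.SatisfiesUnitarity) (hB : D.HasGenuineBlocks)
    (hG : D.SatisfiesGaps A) (hO : D.OPESymmetric) (hT : α.AppliesTermwise D)
    (hI : 0 < α.identityTerm D.Δφ D.Δs)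
    (hTp : ∀ (Δ : ℝ) (ℓ : ℕ) (g : ℝ → ℝ → ℝ), Even ℓ → unitarityBound3D ℓ ≤ Δ → (ℓ = 0 → A.ΔTstar ≤ Δ) →
        IsConformalBlock3D 0 0 Δ ℓ g → 0 ≤ α.tensorForm N D.Δφ g)
    (hAp : ∀ (Δ : ℝ) (ℓ : ℕ) (g : ℝ → ℝ → ℝ), Odd ℓ → unitarityBound3D ℓ ≤ Δ →
        IsConformalBlock3D 0 0 Δ ℓ g → 0 ≤ α.antiForm D.Δφ g)
    (hVp : ∀ (Δ : ℝ) (ℓ : ℕ) (g₁ g₂ : ℝ → ℝ → ℝ), unitarityBound3D ℓ ≤ Δ → (ℓ = 0 → A.ΔVstar ≤ Δ) →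
        IsConformalBlock3D (D.Δφ - D.Δs) (D.Δφ - D.Δs) Δ ℓ g₁ →
          IsConformalBlock3D (-(D.Δφ - D.Δs)) (D.Δφ - D.Δs) Δ ℓ g₂ → 0 ≤ α.vectorForm D.Δφ D.Δs ℓ g₁ g₂)
    (hSp : ∀ (Δ : ℝ) (ℓ : ℕ) (g : ℝ → ℝ → ℝ), Even ℓ → unitarityBound3D ℓ ≤ Δ → (ℓ = 0 → A.ΔSstar ≤ Δ) →
        IsConformalBlock3D 0 0 Δ ℓ g → ∀ a b : ℝ, 0 ≤ α.singletForm D.Δφ D.Δs g a b)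
    (hE : ∀ gs gφm gφp : ℝ → ℝ → ℝ, IsConformalBlock3D 0 0 D.Δs 0 gs →
        IsConformalBlock3D (D.Δφ - D.Δs) (D.Δφ - D.Δs) D.Δφ 0 gφm →
          IsConformalBlock3D (-(D.Δφ - D.Δs)) (D.Δφ - D.Δs) D.Δφ 0 gφp →
            0 ≤ α.extForm D.Δφ D.Δs gs gφm gφp D.lamφφs D.lamsss) : False := by
  obtain ⟨⟨ST₁, SA₁, h1T, h1A, h1e⟩, ⟨SS₂, ST₂, SA₂, h2S, h2T, h2A, h2e⟩,
    ⟨SS₃, ST₃, SA₃, h3S, h3T, h3A, h3e⟩, h4, h5, ⟨SS₆, SV₆, h6S, h6V, h6e⟩,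
    ⟨SS₇, SV₇, h7S, h7V, h7e⟩⟩ := hT
  simp only [ArchipelagoData.Δh] at h5 h6S h6e h7S h7e
  obtain ⟨_, _, hUS, hUT, hUA, hUV⟩ := hU
  obtain ⟨hgs, hgφm, hgφp, hgS, hgT, hgA, hgVm, hgVp⟩ := hB
  obtain ⟨hgapS, hgapV, hgapT⟩ := hG
  -- the singlet series, term by term the `2×2` form at `(λ_{φφ𝒪}, λ_{ss𝒪})`
  have hSser : HasSum (fun i => α.singletForm D.Δφ D.Δs (D.gS i) (D.lamφφS i) (D.lamssS i))
      (SS₂ + SS₃ + -(α.α₄ (crossF D.Δs (-1) (fun _ _ => 1)) + D.lamsss ^ 2 * α.α₄ (crossF D.Δs (-1) D.gs))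
        + SS₆ + SS₇) := by
    have hs := (((h2S.add h3S).add h4).add h6S).add h7S
    refine hs.congr_fun ?_
    intro i
    simp only [singletForm]
    ring
  have hSnn : 0 ≤ SS₂ + SS₃ + -(α.α₄ (crossF D.Δs (-1) (fun _ _ => 1)) +
      D.lamsss ^ 2 * α.α₄ (crossF D.Δs (-1) D.gs)) + SS₆ + SS₇ :=
    hSser.nonneg fun i =>
      hSp (D.ΔS i) (D.ℓS i) (D.gS i) (hUS i).2 (hUS i).1 (hgapS i) (hgS i) (D.lamφφS i) (D.lamssS i)
  -- the traceless-symmetric series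
  have hTser : HasSum (fun i => D.lamT i ^ 2 * α.tensorForm N D.Δφ (D.gT i))
      (ST₁ + (1 - 2 / (N : ℝ)) * ST₂ - (1 + 2 / (N : ℝ)) * ST₃) := by
    have hs := (h1T.add (h2T.mul_left (1 - 2 / (N : ℝ)))).sub (h3T.mul_left (1 + 2 / (N : ℝ)))
    refine hs.congr_fun ?_
    intro i
    simp only [tensorForm]
    ring
  have hTnn : 0 ≤ ST₁ + (1 - 2 / (N : ℝ)) * ST₂ - (1 + 2 / (N : ℝ)) * ST₃ :=
    hTser.nonneg fun i =>
      mul_nonneg (sq_nonneg _) (hTp (D.ΔT i) (D.ℓT i) (D.gT i) (hUT i).2 (hUT i).1 (hgapT i) (hgT i))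
  -- the antisymmetric series
  have hAser : HasSum (fun i => D.lamA i ^ 2 * α.antiForm D.Δφ (D.gA i)) (SA₂ - SA₁ - SA₃) := by
    have hs := (h2A.sub h1A).sub h3A
    refine hs.congr_fun ?_
    intro i
    simp only [antiForm]
    ring
  have hAnn : 0 ≤ SA₂ - SA₁ - SA₃ :=
    hAser.nonneg fun i =>
      mul_nonneg (sq_nonneg _) (hAp (D.ΔA i) (D.ℓA i) (D.gA i) (hUA i).2 (hUA i).1 (hgA i))
  -- the vector series
  have hVser : HasSum (fun j => D.lamV j ^ 2 * α.vectorForm D.Δφ D.Δs (D.ℓV j) (D.gVm j) (D.gVp j))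
      (-(D.lamφsφ ^ 2 * α.α₅ (crossF ((D.Δφ + D.Δs) / 2) (-1) D.gφm)) + SV₆ - SV₇) := by
    have hs := (h5.add h6V).sub h7V
    refine hs.congr_fun ?_
    intro j
    simp only [vectorForm]
    ring
  have hVnn : 0 ≤ -(D.lamφsφ ^ 2 * α.α₅ (crossF ((D.Δφ + D.Δs) / 2) (-1) D.gφm)) + SV₆ - SV₇ :=
    hVser.nonneg fun j =>
      mul_nonneg (sq_nonneg _)
        (hVp (D.ΔV j) (D.ℓV j) (D.gVm j) (D.gVp j) (hUV j) (hgapV j) (hgVm j) (hgVp j))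
  -- the external operators `s`, `φ` at `(λ_{φφs}, λ_{sss})`, using A5
  have hext := hE D.gs D.gφm D.gφp hgs hgφm hgφp
  unfold extForm singletForm vectorForm at hext
  unfold identityTerm at hI
  unfold ArchipelagoData.OPESymmetric at hO
  rw [hO] at hVnn h6e h7e
  simp only [pow_zero, one_mul] at hext
  linarith

/-- **The dual-functional argument, PROVED** ("If such a functional exists for a hypothetical CFT
spectrum, then that spectrum is inconsistent with crossing symmetry", source §2.2): a datum satisfying A1
(bounds, parities), A2 (genuine blocks), A4 (gaps against `A`) and A5 (`λ_{φsφ} = λ_{φφs}`), on which `α⃗`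
acts termwise, cannot have `α⃗` positive at its own `(Δ_φ, Δ_s)` against `A`.  Proof: dualise the seven
rows and add; the singlet series `Σ_S (λ_{φφ𝒪} λ_{ss𝒪}) α⃗·V⃗_S (…)ᵀ`, the tensor, antisymmetric and
vector series `Σ λ² α⃗·V⃗` have non-negative terms, the external operators contribute
`extForm (λ_{φφs}, λ_{sss}) ≥ 0`, and the total is minus the identity term `< 0`.
[cite: KosPolandSimmonsduffin2014, §3.3 eq. (3.16)] -/
theorem not_isPositiveAt_of_appliesTermwise {N : ℕ} (α : ArchipelagoFunctional) (D : ArchipelagoData N)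
    (A : ArchipelagoGaps) (hU : D.SatisfiesUnitarity) (hB : D.HasGenuineBlocks) (hG : D.SatisfiesGaps A)
    (hO : D.OPESymmetric) (hT : α.AppliesTermwise D) (hpos : α.IsPositiveAt N A D.Δφ D.Δs) : False := by
  obtain ⟨hI, hTp, hAp, hVp, hSp, hE⟩ := hpos
  exact not_positiveAtCouplings_of_appliesTermwise α D A hU hB hG hO hT hI hTp hAp hVp hSp
    fun gs gφm gφp h₁ h₂ h₃ => hE gs gφm gφp h₁ h₂ h₃ _ _

/-! ### §3 Evaluation-continuous functionals act termwise; excluded boxes -/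

/-- All seven components of `α⃗` are evaluation-continuous (`EvaluationContinuous` of the `σ–ε` file).
[cite: KosPolandSimmonsduffin2014, §3.2 eq. (3.13)–(3.15)] -/
def IsEvaluationContinuous (α : ArchipelagoFunctional) : Prop :=
  EvaluationContinuous α.α₁ ∧ EvaluationContinuous α.α₂ ∧ EvaluationContinuous α.α₃ ∧
    EvaluationContinuous α.α₄ ∧ EvaluationContinuous α.α₅ ∧ EvaluationContinuous α.α₆ ∧
      EvaluationContinuous α.α₇

section termwise

variable {N : ℕ} {φ : (ℝ → ℝ → ℝ) →ₗ[ℝ] ℝ}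

/-- Row shape `Σ_T − Σ_A = 0` (row 1) dualised by an evaluation-continuous functional. Elementary.
[cite: KosPolandSimmonsduffin2014, §3.2 eq. (3.13)–(3.15)] -/
theorem termwise_twoSeries (hφ : EvaluationContinuous φ) {ι κ : Type} (c : ι → ℝ) (F : ι → ℝ → ℝ → ℝ)
    (d : κ → ℝ) (G : κ → ℝ → ℝ → ℝ) (E : ℝ → ℝ → ℝ) (s t : ℝ)
    (h : ∀ z zb : ℝ, z ∈ Ioo (0 : ℝ) 1 → zb ∈ Ioo (0 : ℝ) 1 → ∃ S T : ℝ,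
      HasSum (fun i => c i * F i z zb) S ∧ HasSum (fun k => d k * G k z zb) T ∧
        E z zb + s * S + t * T = 0) :
    ∃ S T : ℝ, HasSum (fun i => c i * φ (F i)) S ∧ HasSum (fun k => d k * φ (G k)) T ∧
      φ E + s * S + t * T = 0 := by
  have hsF : ∀ z zb : ℝ, z ∈ Ioo (0 : ℝ) 1 → zb ∈ Ioo (0 : ℝ) 1 →
      Summable (fun i => c i * F i z zb) := fun z zb hz hzb => by
    obtain ⟨S, T, hS, _, _⟩ := h z zb hz hzb
    exact hS.summable
  have hsG : ∀ z zb : ℝ, z ∈ Ioo (0 : ℝ) 1 → zb ∈ Ioo (0 : ℝ) 1 →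
      Summable (fun k => d k * G k z zb) := fun z zb hz hzb => by
    obtain ⟨S, T, _, hT, _⟩ := h z zb hz hzb
    exact hT.summable
  refine ⟨_, _, hφ.hasSum_mul_tsum c F hsF, hφ.hasSum_mul_tsum d G hsG, ?_⟩
  have hzero : φ (E + s • (fun z zb => ∑' i, c i * F i z zb) + t • (fun z zb => ∑' k, d k * G k z zb))
      = φ (fun _ _ => (0 : ℝ)) := by
    refine hφ.eq_of_eqOn ?_
    intro z zb hz hzb
    obtain ⟨S, T, hS, hT, he⟩ := h z zb hz hzb
    simp only [Pi.add_apply, Pi.smul_apply, smul_eq_mul]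
    rw [hS.tsum_eq, hT.tsum_eq]
    exact he
  have h0 : φ (fun _ _ => (0 : ℝ)) = 0 := map_zero φ
  rw [map_add, map_add, map_smul, map_smul, h0, smul_eq_mul, smul_eq_mul] at hzero
  exact hzero

/-- Row shape `E + Σ_S + s Σ_T + t Σ_A = 0` (rows 2, 3) dualised by an evaluation-continuous functional.
Elementary. [cite: KosPolandSimmonsduffin2014, §3.2 eq. (3.13)–(3.15)] -/
theorem termwise_threeSeries (hφ : EvaluationContinuous φ) {ι κ μ : Type} (c : ι → ℝ)
    (F : ι → ℝ → ℝ → ℝ) (d : κ → ℝ) (G : κ → ℝ → ℝ → ℝ) (e : μ → ℝ) (H : μ → ℝ → ℝ → ℝ)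
    (E : ℝ → ℝ → ℝ) (s t : ℝ)
    (h : ∀ z zb : ℝ, z ∈ Ioo (0 : ℝ) 1 → zb ∈ Ioo (0 : ℝ) 1 → ∃ S T U : ℝ,
      HasSum (fun i => c i * F i z zb) S ∧ HasSum (fun k => d k * G k z zb) T ∧
        HasSum (fun m => e m * H m z zb) U ∧ E z zb + S + s * T + t * U = 0) :
    ∃ S T U : ℝ, HasSum (fun i => c i * φ (F i)) S ∧ HasSum (fun k => d k * φ (G k)) T ∧
      HasSum (fun m => e m * φ (H m)) U ∧ φ E + S + s * T + t * U = 0 := by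
  have hsF : ∀ z zb : ℝ, z ∈ Ioo (0 : ℝ) 1 → zb ∈ Ioo (0 : ℝ) 1 →
      Summable (fun i => c i * F i z zb) := fun z zb hz hzb => by
    obtain ⟨S, T, U, hS, _, _, _⟩ := h z zb hz hzb
    exact hS.summable
  have hsG : ∀ z zb : ℝ, z ∈ Ioo (0 : ℝ) 1 → zb ∈ Ioo (0 : ℝ) 1 →
      Summable (fun k => d k * G k z zb) := fun z zb hz hzb => by
    obtain ⟨S, T, U, _, hT, _, _⟩ := h z zb hz hzb
    exact hT.summable
  have hsH : ∀ z zb : ℝ, z ∈ Ioo (0 : ℝ) 1 → zb ∈ Ioo (0 : ℝ) 1 →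
      Summable (fun m => e m * H m z zb) := fun z zb hz hzb => by
    obtain ⟨S, T, U, _, _, hU, _⟩ := h z zb hz hzb
    exact hU.summable
  refine ⟨_, _, _, hφ.hasSum_mul_tsum c F hsF, hφ.hasSum_mul_tsum d G hsG,
    hφ.hasSum_mul_tsum e H hsH, ?_⟩
  have hzero : φ (E + (fun z zb => ∑' i, c i * F i z zb) + s • (fun z zb => ∑' k, d k * G k z zb)
      + t • (fun z zb => ∑' m, e m * H m z zb)) = φ (fun _ _ => (0 : ℝ)) := by
    refine hφ.eq_of_eqOn ?_
    intro z zb hz hzb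
    obtain ⟨S, T, U, hS, hT, hU, he⟩ := h z zb hz hzb
    simp only [Pi.add_apply, Pi.smul_apply, smul_eq_mul]
    rw [hS.tsum_eq, hT.tsum_eq, hU.tsum_eq]
    exact he
  have h0 : φ (fun _ _ => (0 : ℝ)) = 0 := map_zero φ
  rw [map_add, map_add, map_add, map_smul, map_smul, h0, smul_eq_mul, smul_eq_mul] at hzero
  exact hzero

/-- Row shape `Σ = −E` (rows 4, 5) dualised by an evaluation-continuous functional. Elementary.
[cite: KosPolandSimmonsduffin2014, §3.2 eq. (3.13)–(3.15)] -/
theorem termwise_oneSeries (hφ : EvaluationContinuous φ) {ι : Type} (c : ι → ℝ) (F : ι → ℝ → ℝ → ℝ)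
    (E : ℝ → ℝ → ℝ)
    (h : ∀ z zb : ℝ, z ∈ Ioo (0 : ℝ) 1 → zb ∈ Ioo (0 : ℝ) 1 →
      HasSum (fun i => c i * F i z zb) (-(E z zb))) :
    HasSum (fun i => c i * φ (F i)) (-(φ E)) := by
  have hs := hφ.hasSum_mul c F (fun z zb => -(E z zb)) h
  have hneg : φ (fun z zb => -(E z zb)) = -(φ E) := by
    rw [← map_neg]; rfl
  simpa [hneg] using hs

end termwise

/-- **T4 for evaluation-continuous functionals**: the crossing axiom A3 alone implies termwise action —
the sector sums of each row are the images of the pointwise `tsum` functions, and the scalar identity of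
the row holds because an evaluation-continuous functional only sees the open square, where the row's
functions add up to `0`. Elementary. [cite: KosPolandSimmonsduffin2014, §3.2 eq. (3.13)–(3.15)] -/
theorem appliesTermwise_of_isEvaluationContinuous {N : ℕ} (α : ArchipelagoFunctional)
    (hα : α.IsEvaluationContinuous) (D : ArchipelagoData N) (hC : D.SatisfiesCrossing) :
    α.AppliesTermwise D := by
  obtain ⟨hα1, hα2, hα3, hα4, hα5, hα6, hα7⟩ := hα
  refine ⟨?_, ?_, ?_, ?_, ?_, ?_, ?_⟩
  · -- row 1: `Σ_T − Σ_A = 0`, as the two-series shape with `E = 0`, `s = 1`, `t = −1`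
    have h := termwise_twoSeries hα1 (fun i => D.lamT i ^ 2) (fun i => crossF D.Δφ (-1) (D.gT i))
      (fun i => D.lamA i ^ 2) (fun i => crossF D.Δφ (-1) (D.gA i)) (fun _ _ => (0 : ℝ)) 1 (-1)
      (fun z zb hz hzb => by
        obtain ⟨ST, SA, hT, hA, he⟩ := (hC z zb hz hzb).1
        exact ⟨ST, SA, hT, hA, by linarith⟩)
    obtain ⟨S, T, hS, hT, he⟩ := h
    have h0 : α.α₁ (fun _ _ => (0 : ℝ)) = 0 := map_zero α.α₁
    exact ⟨S, T, hS, hT, by rw [h0] at he; linarith⟩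
  · -- row 2
    have h := termwise_threeSeries hα2 (fun i => D.lamφφS i ^ 2) (fun i => crossF D.Δφ (-1) (D.gS i))
      (fun i => D.lamT i ^ 2) (fun i => crossF D.Δφ (-1) (D.gT i)) (fun i => D.lamA i ^ 2)
      (fun i => crossF D.Δφ (-1) (D.gA i))
      (fun z zb => crossF D.Δφ (-1) (fun _ _ => 1) z zb + D.lamφφs ^ 2 * crossF D.Δφ (-1) D.gs z zb)
      (1 - 2 / (N : ℝ)) 1
      (fun z zb hz hzb => by
        obtain ⟨SS, ST, SA, hS, hT, hA, he⟩ := (hC z zb hz hzb).2.1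
        exact ⟨SS, ST, SA, hS, hT, hA, by linarith⟩)
    obtain ⟨S, T, U, hS, hT, hU, he⟩ := h
    have hE : α.α₂ (fun z zb => crossF D.Δφ (-1) (fun _ _ => 1) z zb +
        D.lamφφs ^ 2 * crossF D.Δφ (-1) D.gs z zb)
        = α.α₂ (crossF D.Δφ (-1) (fun _ _ => 1)) + D.lamφφs ^ 2 * α.α₂ (crossF D.Δφ (-1) D.gs) := by
      rw [← smul_eq_mul (a := D.lamφφs ^ 2) (b := α.α₂ (crossF D.Δφ (-1) D.gs)), ← map_smul, ← map_add]
      rfl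
    exact ⟨S, T, U, hS, hT, hU, by rw [hE] at he; linarith⟩
  · -- row 3
    have h := termwise_threeSeries hα3 (fun i => D.lamφφS i ^ 2) (fun i => crossF D.Δφ 1 (D.gS i))
      (fun i => D.lamT i ^ 2) (fun i => crossF D.Δφ 1 (D.gT i)) (fun i => D.lamA i ^ 2)
      (fun i => crossF D.Δφ 1 (D.gA i))
      (fun z zb => crossF D.Δφ 1 (fun _ _ => 1) z zb + D.lamφφs ^ 2 * crossF D.Δφ 1 D.gs z zb)
      (-(1 + 2 / (N : ℝ))) (-1)
      (fun z zb hz hzb => by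
        obtain ⟨SS, ST, SA, hS, hT, hA, he⟩ := (hC z zb hz hzb).2.2.1
        exact ⟨SS, ST, SA, hS, hT, hA, by linarith⟩)
    obtain ⟨S, T, U, hS, hT, hU, he⟩ := h
    have hE : α.α₃ (fun z zb => crossF D.Δφ 1 (fun _ _ => 1) z zb +
        D.lamφφs ^ 2 * crossF D.Δφ 1 D.gs z zb)
        = α.α₃ (crossF D.Δφ 1 (fun _ _ => 1)) + D.lamφφs ^ 2 * α.α₃ (crossF D.Δφ 1 D.gs) := by
      rw [← smul_eq_mul (a := D.lamφφs ^ 2) (b := α.α₃ (crossF D.Δφ 1 D.gs)), ← map_smul, ← map_add]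
      rfl
    exact ⟨S, T, U, hS, hT, hU, by rw [hE] at he; linarith⟩
  · -- row 4
    have h := termwise_oneSeries hα4 (fun i => D.lamssS i ^ 2) (fun i => crossF D.Δs (-1) (D.gS i))
      (fun z zb => crossF D.Δs (-1) (fun _ _ => 1) z zb + D.lamsss ^ 2 * crossF D.Δs (-1) D.gs z zb)
      (fun z zb hz hzb => (hC z zb hz hzb).2.2.2.1)
    have hE : α.α₄ (fun z zb => crossF D.Δs (-1) (fun _ _ => 1) z zb +
        D.lamsss ^ 2 * crossF D.Δs (-1) D.gs z zb)
        = α.α₄ (crossF D.Δs (-1) (fun _ _ => 1)) + D.lamsss ^ 2 * α.α₄ (crossF D.Δs (-1) D.gs) := by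
      rw [← smul_eq_mul (a := D.lamsss ^ 2) (b := α.α₄ (crossF D.Δs (-1) D.gs)), ← map_smul, ← map_add]
      rfl
    rw [hE] at h
    exact h
  · -- row 5
    have h := termwise_oneSeries hα5 (fun j => (-1 : ℝ) ^ D.ℓV j * D.lamV j ^ 2)
      (fun j => crossF D.Δh (-1) (D.gVm j)) (fun z zb => D.lamφsφ ^ 2 * crossF D.Δh (-1) D.gφm z zb)
      (fun z zb hz hzb => (hC z zb hz hzb).2.2.2.2.1)
    have hE : α.α₅ (fun z zb => D.lamφsφ ^ 2 * crossF D.Δh (-1) D.gφm z zb)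
        = D.lamφsφ ^ 2 * α.α₅ (crossF D.Δh (-1) D.gφm) := by
      rw [← smul_eq_mul (a := D.lamφsφ ^ 2) (b := α.α₅ (crossF D.Δh (-1) D.gφm)), ← map_smul]
      rfl
    rw [hE] at h
    exact h
  · -- row 6
    have h := termwise_twoSeries hα6 (fun i => D.lamφφS i * D.lamssS i) (fun i => crossF D.Δh (-1) (D.gS i))
      (fun j => D.lamV j ^ 2) (fun j => crossF D.Δφ (-1) (D.gVp j))
      (fun z zb => crossF D.Δh (-1) (fun _ _ => 1) z zb + D.lamφφs * D.lamsss * crossF D.Δh (-1) D.gs z zb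
        + D.lamφsφ ^ 2 * crossF D.Δφ (-1) D.gφp z zb) 1 1
      (fun z zb hz hzb => by
        obtain ⟨SS, SV, hS, hV, he⟩ := (hC z zb hz hzb).2.2.2.2.2.1
        exact ⟨SS, SV, hS, hV, by linarith⟩)
    obtain ⟨S, T, hS, hT, he⟩ := h
    have hE : α.α₆ (fun z zb => crossF D.Δh (-1) (fun _ _ => 1) z zb +
        D.lamφφs * D.lamsss * crossF D.Δh (-1) D.gs z zb + D.lamφsφ ^ 2 * crossF D.Δφ (-1) D.gφp z zb)
        = α.α₆ (crossF D.Δh (-1) (fun _ _ => 1)) + D.lamφφs * D.lamsss * α.α₆ (crossF D.Δh (-1) D.gs)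
          + D.lamφsφ ^ 2 * α.α₆ (crossF D.Δφ (-1) D.gφp) := by
      rw [← smul_eq_mul (a := D.lamφφs * D.lamsss) (b := α.α₆ (crossF D.Δh (-1) D.gs)),
        ← smul_eq_mul (a := D.lamφsφ ^ 2) (b := α.α₆ (crossF D.Δφ (-1) D.gφp)), ← map_smul, ← map_smul,
        ← map_add, ← map_add]
      rfl
    exact ⟨S, T, hS, hT, by rw [hE] at he; linarith⟩
  · -- row 7
    have h := termwise_twoSeries hα7 (fun i => D.lamφφS i * D.lamssS i) (fun i => crossF D.Δh 1 (D.gS i))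
      (fun j => D.lamV j ^ 2) (fun j => crossF D.Δφ 1 (D.gVp j))
      (fun z zb => crossF D.Δh 1 (fun _ _ => 1) z zb + D.lamφφs * D.lamsss * crossF D.Δh 1 D.gs z zb
        - D.lamφsφ ^ 2 * crossF D.Δφ 1 D.gφp z zb) 1 (-1)
      (fun z zb hz hzb => by
        obtain ⟨SS, SV, hS, hV, he⟩ := (hC z zb hz hzb).2.2.2.2.2.2
        exact ⟨SS, SV, hS, hV, by linarith⟩)
    obtain ⟨S, T, hS, hT, he⟩ := h
    have hE : α.α₇ (fun z zb => crossF D.Δh 1 (fun _ _ => 1) z zb +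
        D.lamφφs * D.lamsss * crossF D.Δh 1 D.gs z zb - D.lamφsφ ^ 2 * crossF D.Δφ 1 D.gφp z zb)
        = α.α₇ (crossF D.Δh 1 (fun _ _ => 1)) + D.lamφφs * D.lamsss * α.α₇ (crossF D.Δh 1 D.gs)
          - D.lamφsφ ^ 2 * α.α₇ (crossF D.Δφ 1 D.gφp) := by
      rw [← smul_eq_mul (a := D.lamφφs * D.lamsss) (b := α.α₇ (crossF D.Δh 1 D.gs)),
        ← smul_eq_mul (a := D.lamφsφ ^ 2) (b := α.α₇ (crossF D.Δφ 1 D.gφp)), ← map_smul, ← map_smul,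
        ← map_add, ← map_sub]
      rfl
    exact ⟨S, T, hS, hT, by rw [hE] at he; linarith⟩

/-- **Box-uniform exclusion by one functional**: if `α⃗` is evaluation-continuous and positive against
`A` at EVERY point of `Q`, then `BoxExcluded N A Q` — no datum satisfying A1–A5 against `A` has
`(Δ_φ, Δ_s) ∈ Q` (source §2.2, with termwise action proved rather than assumed).
[cite: KosPolandSimmonsDuffinVichi2015, §2.2 (functional conditions)] -/
theorem boxExcluded_of_functional {N : ℕ} (A : ArchipelagoGaps) (Q : Set (ℝ × ℝ))
    (α : ArchipelagoFunctional) (hα : α.IsEvaluationContinuous)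
    (hpos : ∀ p ∈ Q, α.IsPositiveAt N A p.1 p.2) : BoxExcluded N A Q := by
  intro D hD hQ
  obtain ⟨hB, hU, _, hC, hG, hO⟩ := hD
  have hP : α.IsPositiveAt N A D.Δφ D.Δs := hpos (D.Δφ, D.Δs) hQ
  exact not_isPositiveAt_of_appliesTermwise α D A hU hB hG hO
    (appliesTermwise_of_isEvaluationContinuous α hα D hC) hP

/-! ### §4 Point-evaluation 7-vectors -/

/-- The 7-vector of point-evaluation functionals on common nodes `(z_k, z̄_k)` with weight table
`w : Fin 7 → Fin n → ℝ` (`w 0` for `α₁`, …, `w 6` for `α₇`); `pointFunctional` of the `σ–ε` file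
(Hogervorst–Rychkov 2013, §4.3: crossing imposed point by point). [cite: HogervorstRychkov2013, §4.3] -/
noncomputable def ofPoints {n : ℕ} (z zb : Fin n → ℝ) (w : Fin 7 → Fin n → ℝ) : ArchipelagoFunctional where
  α₁ := pointFunctional (w 0) z zb
  α₂ := pointFunctional (w 1) z zb
  α₃ := pointFunctional (w 2) z zb
  α₄ := pointFunctional (w 3) z zb
  α₅ := pointFunctional (w 4) z zb
  α₆ := pointFunctional (w 5) z zb
  α₇ := pointFunctional (w 6) z zb

/-- Point-evaluation 7-vectors with nodes in the open square are evaluation-continuous.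
[cite: HogervorstRychkov2013, §4.3] -/
theorem isEvaluationContinuous_ofPoints {n : ℕ} (z zb : Fin n → ℝ) (w : Fin 7 → Fin n → ℝ)
    (hz : ∀ k, z k ∈ Ioo (0 : ℝ) 1) (hzb : ∀ k, zb k ∈ Ioo (0 : ℝ) 1) :
    (ofPoints z zb w).IsEvaluationContinuous :=
  ⟨evaluationContinuous_pointFunctional _ z zb hz hzb, evaluationContinuous_pointFunctional _ z zb hz hzb,
    evaluationContinuous_pointFunctional _ z zb hz hzb, evaluationContinuous_pointFunctional _ z zb hz hzb,
    evaluationContinuous_pointFunctional _ z zb hz hzb, evaluationContinuous_pointFunctional _ z zb hz hzb,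
    evaluationContinuous_pointFunctional _ z zb hz hzb⟩

/-- **What one certificate proves.** A point-evaluation 7-vector with nodes in the open square, positive
against `A` at every `(Δ_φ, Δ_s) ∈ Q`, excludes `Q`: `BoxExcluded N A Q`, the hypothesis of
`archipelagoEnclosure_of_cover`.  Fully proved; the burden of a certificate is `hpos` (positivity on
every genuine block, box-uniformly). [cite: KosPolandSimmonsDuffinVichi2015, §2.2 (functional conditions)] -/
theorem boxExcluded_of_pointFunctional {N n : ℕ} (A : ArchipelagoGaps) (z zb : Fin n → ℝ)
    (w : Fin 7 → Fin n → ℝ) (hz : ∀ k, z k ∈ Ioo (0 : ℝ) 1) (hzb : ∀ k, zb k ∈ Ioo (0 : ℝ) 1)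
    (Q : Set (ℝ × ℝ)) (hpos : ∀ p ∈ Q, (ofPoints z zb w).IsPositiveAt N A p.1 p.2) :
    BoxExcluded N A Q :=
  boxExcluded_of_functional A Q _ (isEvaluationContinuous_ofPoints z zb w hz hzb) hpos

/-! ### §5 Entrywise criteria for the `2×2` forms -/

/-- Entrywise criterion for the singlet form: with `X = α₂[F⁻_{Δφ} g] + α₃[F⁺_{Δφ} g]`,
`Y = α₄[F⁻_{Δs} g]`, `Z = α₆[F⁻_h g] + α₇[F⁺_h g]`, the inequalities `X, Y ≥ 0`, `Z² ≤ 4XY` give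
`singletForm g a b ≥ 0` for all `(a, b)` (`quadForm_nonneg_of_det`). Elementary.
[cite: KosPolandSimmonsDuffinVichi2015, §2.2 (functional conditions)] -/
theorem singletForm_nonneg_of_det (α : ArchipelagoFunctional) (Δφ Δs : ℝ) (g : ℝ → ℝ → ℝ)
    (hX : 0 ≤ α.α₂ (crossF Δφ (-1) g) + α.α₃ (crossF Δφ 1 g)) (hY : 0 ≤ α.α₄ (crossF Δs (-1) g))
    (hZ : (α.α₆ (crossF ((Δφ + Δs) / 2) (-1) g) + α.α₇ (crossF ((Δφ + Δs) / 2) 1 g)) ^ 2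
      ≤ 4 * (α.α₂ (crossF Δφ (-1) g) + α.α₃ (crossF Δφ 1 g)) * α.α₄ (crossF Δs (-1) g)) (a b : ℝ) :
    0 ≤ α.singletForm Δφ Δs g a b := by
  unfold singletForm
  exact quadForm_nonneg_of_det hX hY hZ a b

/-- Entrywise criterion for the external form: with `X = α₂[F⁻_{Δφ} g_s] + α₃[F⁺_{Δφ} g_s] +
vectorForm 0 g_φ^- g_φ^+`, `Y = α₄[F⁻_{Δs} g_s]`, `Z = α₆[F⁻_h g_s] + α₇[F⁺_h g_s]`, the inequalities
`X, Y ≥ 0`, `Z² ≤ 4XY` give `extForm ≥ 0` for all `(a, b)`. Elementary.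
[cite: KosPolandSimmonsDuffinVichi2015, §2.2 (OPE-coefficient symmetry)] -/
theorem extForm_nonneg_of_det (α : ArchipelagoFunctional) (Δφ Δs : ℝ) (gs gφm gφp : ℝ → ℝ → ℝ)
    (hX : 0 ≤ α.α₂ (crossF Δφ (-1) gs) + α.α₃ (crossF Δφ 1 gs) + α.vectorForm Δφ Δs 0 gφm gφp)
    (hY : 0 ≤ α.α₄ (crossF Δs (-1) gs))
    (hZ : (α.α₆ (crossF ((Δφ + Δs) / 2) (-1) gs) + α.α₇ (crossF ((Δφ + Δs) / 2) 1 gs)) ^ 2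
      ≤ 4 * (α.α₂ (crossF Δφ (-1) gs) + α.α₃ (crossF Δφ 1 gs) + α.vectorForm Δφ Δs 0 gφm gφp)
        * α.α₄ (crossF Δs (-1) gs)) (a b : ℝ) :
    0 ≤ α.extForm Δφ Δs gs gφm gφp a b := by
  have h := quadForm_nonneg_of_det hX hY hZ a b
  unfold extForm singletForm
  linarith

/-- Without using A5: if the singlet form of `g_s` is PSD and the vector form of `(g_φ^-, g_φ^+)` at
`ℓ = 0` is `≥ 0` separately, the external form is PSD ("if we assume no gap between `φ_i`, `s` and the
next operators in each sector, enforcing symmetry of the OPE coefficients will have no effect: indeed each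
of the terms in this constraint would be independently positive-semidefinite", source §2.2). Elementary.
[cite: KosPolandSimmonsDuffinVichi2015, §2.2 (OPE-coefficient symmetry)] -/
theorem extForm_nonneg_of_separate (α : ArchipelagoFunctional) (Δφ Δs : ℝ) (gs gφm gφp : ℝ → ℝ → ℝ)
    (hS : ∀ a b : ℝ, 0 ≤ α.singletForm Δφ Δs gs a b) (hV : 0 ≤ α.vectorForm Δφ Δs 0 gφm gφp)
    (a b : ℝ) : 0 ≤ α.extForm Δφ Δs gs gφm gφp a b := by
  unfold extForm
  exact add_nonneg (hS a b) (mul_nonneg (sq_nonneg a) hV)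

end ArchipelagoFunctional

/-! ### §6 Assembly of a certificate family on a product grid -/

/-- **Assembly on a product grid**: let the window be `W = [x₀, x_K] × [y₀, y_M]` in the `(Δ_φ, Δ_s)`
plane with grid abscissae `x_k` and ordinates `y_m` (`K, M ≥ 1`; a certificate uses rationals).  If every
grid cell is either contained in the region `R` or excluded against `A` (`BoxExcluded N A`, one certified
7-vector per cell, `boxExcluded_of_pointFunctional`), then `ArchipelagoEnclosure N A W R` — the island is
what is left of the window (the cover lemma `Icc_prod_subset_iUnion_cells` of the `σ–ε` file and
`archipelagoEnclosure_of_cover`).  Source §3.1: the `O(2)` island is obtained by excluding the points of a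
window around it. [cite: KosPolandSimmonsDuffinVichi2015, §3.1 (O(2): gaps, OPE symmetry, closed island)] -/
theorem archipelagoEnclosure_of_grid {N : ℕ} (A : ArchipelagoGaps) (x y : ℕ → ℝ) {K M : ℕ} (hK : 1 ≤ K)
    (hM : 1 ≤ M) (R : Set (ℝ × ℝ))
    (hcell : ∀ k, k < K → ∀ m, m < M →
      Icc (x k) (x (k + 1)) ×ˢ Icc (y m) (y (m + 1)) ⊆ R ∨
        BoxExcluded N A (Icc (x k) (x (k + 1)) ×ˢ Icc (y m) (y (m + 1)))) :
    ArchipelagoEnclosure N A (Icc (x 0) (x K) ×ˢ Icc (y 0) (y M)) R := by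
  intro D hD hW
  have hmem := ConformalBootstrap3D.Icc_prod_subset_iUnion_cells x y hK hM hW
  simp only [mem_iUnion, Finset.mem_range, exists_prop] at hmem
  obtain ⟨k, hk, m, hm, hcellmem⟩ := hmem
  rcases hcell k hk m hm with hR | hX
  · exact hR hcellmem
  · exact (hX D hD hcellmem).elim

end Literature.MathematicalPhysics.QuantumFieldTheory.ONArchipelagoSystem
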